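import Summits.QuantumFields.BalabanUV.Beta.GAN24.SndDiffRowSumTransport
import Summits.QuantumFields.BalabanUV.Beta.GAN24.Entry115SupCubic

/-!
# Row G-an2-4 ∕ (CONV-C) — the SECOND-ORDER sup letters, END PACKAGING (S2-f): the localized and the global `ℓ^∞ → ℓ^∞` entries of
# `∇_μ∇_νΔ_1⁻¹` and `Δ_1⁻¹∇_μ^*∇_ν^*` at `U = 1`, `a = 1`, on CUBIC unit tori, WITH AN ALLOWANCE — from per-block row sums; the
# `(1 + log n)` instances CONDITIONAL on the flat suppliers' second-order rows

NOT IN PRINT; OUR BOOKKEEPING.  Cell `pub-balaban`, G-an2-4 crux team (coordinator ruling e34b3e0c (2)), leaf seat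
`b2b-balaban-gan24-formalise-leaf-04` (gen 47), item «S2-TRANSPORT∕END» (journal `CLAIMS.log` l.28813), FILE 2 of 2 (FILE 1 =
`GAN24/SndDiffRowSumTransport`).  The road-P2 owner (`b2b-balaban-gan24-p2` gen 29, l.28555) reduced its sup-norm one-step law for the soft
minimiser to four sup quantities, two of them NEW second-order entries «`G∇*∇*` row sums `‖G′∂′ᴴ∂′ᴴ‖_{∞→∞}` (the expected log) and pure
second differences, with a `log n` allowance»; `…-leaf-01` (l.28781) typed the letters `Entry112GradGradLog ∕ Entry112GDivDivLog ∕
Sup112GradGradLog ∕ Sup112GDivDivLog d a` (staged); `…-leaf-03` (l.28719) ∕ `…-leaf-06` (l.28735) supply the flat second-order rows.  THIS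
FILE packages: per-block row sums (FILE 1) ⇒ the letters' BODIES at `M := fun _ => N₀` — my gen-46 pattern (`Entry110GradCubic` §2,
`Entry115SupCubic` §1) applied to the second-order matrices; no Support leaf, no new object, no Literature fact, 0 `def`, 0 `def … : Prop`.

WHAT IS PROVED (kernel; `G = Δ_a⁻¹ = (B5DeltaA169.DeltaA n M a)⁻¹`, `∇_ν = fdiff (fine n M) n ν`, `∇_ν^* = (fdiff …)ᴴ`, unit cubes
`B(y) = {bpt n M (toT M y) r}`, label distance `torusSupNorm M (y − y′)`, `K_{d+1} = B4Sect5Proof.latticeConst (d+1)`):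
 * §1 REDUCTIONS, ANY torus, ANY `a`, ANY allowance `A : ℕ → ℝ` — **`entry112GradGrad_of_block_row_sum`** ∕ **`entry112GDivDiv_of_block_row_sum`**:
   per-block row bounds `Σ_{x′ : blockOf x′ = y′} ‖K(i,x′)‖ ≤ B₂·A(n)·e^{−δ|blockOf i − y′|_{T₁,∞}}` for `K = ∇_μ·∇_ν·Δ_a⁻¹` resp.
   `K = Δ_a⁻¹·∇_μ^*·∇_ν^*` on every torus ⟹ the localized sup letters «`‖(K J)(x)‖ ≤ B₂·A(n)·e^{−δ|y−y′|_∞}·|J|`, supp J ⊆ B(y′)»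
   (`Entry110GradCubic.norm_mulVec_bpt_le_of_block_row_sum` BY NAME); **`sup112GradGrad_of_block_row_sum`** ∕ **`sup112GDivDiv_of_block_row_sum`**:
   the same ⟹ the GLOBAL letters «`‖K J‖_∞ ≤ B₂·K_{d+1}(δ)·A(n)·|J|`», i.e. `‖K‖_{ℓ^∞→ℓ^∞} ≤ B₂·K_{d+1}(δ)·A(n)` uniformly in the volume
   (`Entry115SupCubic.norm_mulVec_le_of_block_row_sum` BY NAME; `latticeConst_succ_pos`);
 * §2 ENDs AT `a = 1` ON CUBIC UNIT TORI WITH THE `(1 + log n)` ALLOWANCE, CONDITIONAL ON THE FLAT SECOND-ORDER ROWS (FILE 1 §3's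
   hypotheses — the suppliers' announced END shapes, NOT proved here): **`entry112GradGrad_one_cubic_of_flat`** ∕ **`sup112GradGrad_one_cubic_of_flat`**
   (row form, from the flat `rowDiff μ (rowDiff ν (gFlat j))` rows) and **`entry112GDivDiv_one_cubic_of_flat`** ∕ **`sup112GDivDiv_one_cubic_of_flat`**
   (operator form, from the flat `gFlat j·colDiff μ·colDiff ν` rows) — the BODIES of `…-leaf-01`'s staged `Entry112GradGradLog d 1` ∕
   `Sup112GradGradLog d 1` ∕ `Entry112GDivDivLog d 1` ∕ `Sup112GDivDivLog d 1` VERBATIM at `M := fun _ => N₀`; the last one is the requester's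
   letter `‖G∇_μ^*∇_ν^*‖_{∞→∞} ≤ C·(1 + log n)` in the vector currency on cubic tori.

HONEST SCOPE.  [folklore] packaging; 0 estimates of any propagator in this file: §1 takes per-block bounds as hypotheses, §2 takes the flat
second-order rows as hypotheses (at this file's writing proved by nobody in the tree; the day a flat END lands in the announced shape the
hypothesis is discharged BY NAME and the four ENDs become unconditional on cubic tori — a 3-line rider, nothing else changes; another
allowance is a re-instantiation of §1, not a rewrite).  `a = 1`, `U = 1`, CUBIC tori in §2; the VECTOR carrier `Δ_1⁻¹` — the requester's
scalar `G′ = ScalarAveragedPropagator.Gps` is NOT treated (no scalar flat chain exists).  The printed [B5] Prop. 1.2 second-order entries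
(1.112)–(1.113) (`Balaban1984PropagatorsI` pp. 35–36) are HÖLDER-norm statements without a log — a TEXT LOCATION; the `ℓ^∞` letters with
`(1 + log n)` are OURS.  No shape-certificate `example` against `…-leaf-01`'s named Props is given because that statement file is staged,
not in the tree (its §1 bodies were copied symbol for symbol).  NOT (CONV-C), NEVER «G-an2-4 closed», NOT NE2 ∕ NE3, NOT D1, NOT BetaPertH,
NOT the continuum limit, NOT Clay.  HONEST DEPENDENCY: continuum YM on T⁴ ⇐ BetaPertH ∧ nine spine estimates (0/9 proved); BetaPertH ⇐
(D1) ∧ (D4) ∧ CAP+tail; G-an2-4 gates asym, D1 and NE2/3/4.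
-/

noncomputable section

open scoped BigOperators ComplexConjugate Matrix
open Finset

namespace Summit.QuantumFields.BalabanUV.Beta.GAN24.Entry112SupLogCubic

open Literature.MathematicalPhysics.QuantumFieldTheory.Balaban1983to89
open Literature.MathematicalPhysics.QuantumFieldTheory.Balaban1983to89.TreeLengthTorus (TPt)
open B5Prop11Plancherel (Tor fine fdiff)
open B5Block118 (bpt)
open B5Blocks16 (blockOf)
open B6LowerBound2153Torus (toT rep)
open B5DeltaA169 (DeltaA)
open B4TorusKernel.MultiPeriod (torusSupNorm)
open B4Sect5Proof (latticeConst latticeConst_nonneg)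
open Summit.QuantumFields.BalabanUV.T4Continuum
open SliceTorusBlocks SliceTorusTower SliceCovariantTower SliceFlatPropagator SliceFlatFreeResolvent SliceFlatGradientPrep
open Entry110GradCubic Entry115SupCubic SndDiffRowSumTransport

variable {d : ℕ}

/-! ## §0 The torus-sum constant is positive -/

/-- `K_{d+1}(δ) = (2(1 − e^{−δ/(d+1)}))^{−(d+1)} > 0` for `δ > 0` (`B4Sect5Proof.latticeConst`). [folklore] -/
theorem latticeConst_succ_pos {δ : ℝ} (hδ : 0 < δ) : 0 < latticeConst (d + 1) δ := by
  unfold latticeConst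
  have h1 : Real.exp (-(δ / ((d + 1 : ℕ) : ℝ))) < 1 := by
    rw [Real.exp_lt_one_iff]
    have : (0 : ℝ) < ((d + 1 : ℕ) : ℝ) := by positivity
    exact neg_neg_of_pos (div_pos hδ this)
  have h2 : 0 < 2 * (1 - Real.exp (-(δ / ((d + 1 : ℕ) : ℝ)))) := by linarith
  positivity

/-! ## §1 Reductions: per-block row sums with an allowance ⇒ the localized and the global second-order sup letters (any torus, any `a`) -/

section Reductions

variable (d) (a : ℝ) (A : ℕ → ℝ)

/-- **ROW FORM, LOCALIZED: per-block row sums of `∇_μ·∇_ν·Δ_a⁻¹` with allowance `A(n)` on every torus ⟹ the letter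
«`‖(∇_μ∇_νΔ_a⁻¹J)_κ(x)‖ ≤ B₂·A(n)·e^{−δ|y−y′|_∞}·|J|`, `x ∈ B(y)`, supp J ⊆ B(y′)»** (with `A n = 1 + log n` this is the body of
`…-leaf-01`'s `Entry112GradGradLog d a`). [folklore] -/
theorem entry112GradGrad_of_block_row_sum
    (h : ∃ B₂ δ : ℝ, 0 < B₂ ∧ 0 < δ ∧ ∀ (n : ℕ) (M : Fin (d + 1) → ℕ) [NeZero n] [∀ μ, NeZero (M μ)],
      ∀ (μ ν : Fin (d + 1)) (i : Tor (fine n M) × Fin (d + 1)) (y' : Tor M),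
        ∑ x' : Tor (fine n M) × Fin (d + 1),
            (if blockOf n M x'.1 = y' then
              ‖(fdiff (fine n M) (n : ℂ) μ * fdiff (fine n M) (n : ℂ) ν * (DeltaA n M a)⁻¹) i x'‖ else 0)
          ≤ B₂ * A n * Real.exp (-(δ * torusSupNorm M (rep M (blockOf n M i.1) - rep M y')))) :
    ∃ δ₀ C : ℝ, 0 < δ₀ ∧ 0 < C ∧
      ∀ (n : ℕ) (M : Fin (d + 1) → ℕ) [NeZero n] [∀ μ, NeZero (M μ)], 1 ≤ n →
        ∀ (μ ν : Fin (d + 1)) (y y' : Fin (d + 1) → ℤ) (J : Tor (fine n M) × Fin (d + 1) → ℂ) (B : ℝ),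
          (∀ j, ‖J j‖ ≤ B) → (∀ j, J j ≠ 0 → ∃ r' : Fin (d + 1) → Fin n, j.1 = bpt n M (toT M y') r') →
          ∀ (r : Fin (d + 1) → Fin n) (κ : Fin (d + 1)),
            ‖(fdiff (fine n M) (n : ℂ) μ *ᵥ (fdiff (fine n M) (n : ℂ) ν *ᵥ ((DeltaA n M a)⁻¹ *ᵥ J)))
                (bpt n M (toT M y) r, κ)‖
              ≤ C * A n * Real.exp (-(δ₀ * torusSupNorm M (y - y'))) * B := by
  obtain ⟨B₂, δ, hB, hδ, hblock⟩ := h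
  refine ⟨δ, B₂, hδ, hB, ?_⟩
  intro n M _ _ _hn μ ν y y' J B hJB hsupp r κ
  simp only [Matrix.mulVec_mulVec, ← Matrix.mul_assoc]
  exact norm_mulVec_bpt_le_of_block_row_sum n M _ (fun i y₁ => hblock n M μ ν i y₁) y y' J hJB hsupp r κ

/-- **OPERATOR FORM, LOCALIZED: per-block row sums of `Δ_a⁻¹·∇_μ^*·∇_ν^*` with allowance `A(n)` on every torus ⟹ the letter
«`‖(Δ_a⁻¹∇_μ^*∇_ν^*J)_κ(x)‖ ≤ B₂·A(n)·e^{−δ|y−y′|_∞}·|J|`, supp J ⊆ B(y′)»** (with `A n = 1 + log n`: the body of `Entry112GDivDivLog d a`).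
[folklore] -/
theorem entry112GDivDiv_of_block_row_sum
    (h : ∃ B₂ δ : ℝ, 0 < B₂ ∧ 0 < δ ∧ ∀ (n : ℕ) (M : Fin (d + 1) → ℕ) [NeZero n] [∀ μ, NeZero (M μ)],
      ∀ (μ ν : Fin (d + 1)) (i : Tor (fine n M) × Fin (d + 1)) (y' : Tor M),
        ∑ x' : Tor (fine n M) × Fin (d + 1),
            (if blockOf n M x'.1 = y' then
              ‖((DeltaA n M a)⁻¹ * (fdiff (fine n M) (n : ℂ) μ)ᴴ * (fdiff (fine n M) (n : ℂ) ν)ᴴ) i x'‖ else 0)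
          ≤ B₂ * A n * Real.exp (-(δ * torusSupNorm M (rep M (blockOf n M i.1) - rep M y')))) :
    ∃ δ₀ C : ℝ, 0 < δ₀ ∧ 0 < C ∧
      ∀ (n : ℕ) (M : Fin (d + 1) → ℕ) [NeZero n] [∀ μ, NeZero (M μ)], 1 ≤ n →
        ∀ (μ ν : Fin (d + 1)) (y y' : Fin (d + 1) → ℤ) (J : Tor (fine n M) × Fin (d + 1) → ℂ) (B : ℝ),
          (∀ j, ‖J j‖ ≤ B) → (∀ j, J j ≠ 0 → ∃ r' : Fin (d + 1) → Fin n, j.1 = bpt n M (toT M y') r') →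
          ∀ (r : Fin (d + 1) → Fin n) (κ : Fin (d + 1)),
            ‖((DeltaA n M a)⁻¹ *ᵥ ((fdiff (fine n M) (n : ℂ) μ)ᴴ *ᵥ ((fdiff (fine n M) (n : ℂ) ν)ᴴ *ᵥ J)))
                (bpt n M (toT M y) r, κ)‖
              ≤ C * A n * Real.exp (-(δ₀ * torusSupNorm M (y - y'))) * B := by
  obtain ⟨B₂, δ, hB, hδ, hblock⟩ := h
  refine ⟨δ, B₂, hδ, hB, ?_⟩
  intro n M _ _ _hn μ ν y y' J B hJB hsupp r κ
  simp only [Matrix.mulVec_mulVec, ← Matrix.mul_assoc]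
  exact norm_mulVec_bpt_le_of_block_row_sum n M _ (fun i y₁ => hblock n M μ ν i y₁) y y' J hJB hsupp r κ

/-- **ROW FORM, GLOBAL: per-block row sums of `∇_μ·∇_ν·Δ_a⁻¹` with allowance `A(n)` ⟹ `‖∇_μ∇_νΔ_a⁻¹‖_{ℓ^∞→ℓ^∞} ≤ B₂·K_{d+1}(δ)·A(n)`**,
uniformly in the torus (with `A n = 1 + log n`: the body of `Sup112GradGradLog d a`). [folklore] -/
theorem sup112GradGrad_of_block_row_sum
    (h : ∃ B₂ δ : ℝ, 0 < B₂ ∧ 0 < δ ∧ ∀ (n : ℕ) (M : Fin (d + 1) → ℕ) [NeZero n] [∀ μ, NeZero (M μ)],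
      ∀ (μ ν : Fin (d + 1)) (i : Tor (fine n M) × Fin (d + 1)) (y' : Tor M),
        ∑ x' : Tor (fine n M) × Fin (d + 1),
            (if blockOf n M x'.1 = y' then
              ‖(fdiff (fine n M) (n : ℂ) μ * fdiff (fine n M) (n : ℂ) ν * (DeltaA n M a)⁻¹) i x'‖ else 0)
          ≤ B₂ * A n * Real.exp (-(δ * torusSupNorm M (rep M (blockOf n M i.1) - rep M y')))) :
    ∃ C : ℝ, 0 < C ∧
      ∀ (n : ℕ) (M : Fin (d + 1) → ℕ) [NeZero n] [∀ μ, NeZero (M μ)], 1 ≤ n →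
        ∀ (μ ν : Fin (d + 1)) (J : Tor (fine n M) × Fin (d + 1) → ℂ) (B : ℝ), (∀ j, ‖J j‖ ≤ B) →
          ∀ i, ‖(fdiff (fine n M) (n : ℂ) μ *ᵥ (fdiff (fine n M) (n : ℂ) ν *ᵥ ((DeltaA n M a)⁻¹ *ᵥ J))) i‖
              ≤ C * A n * B := by
  obtain ⟨B₂, δ, hB, hδ, hblock⟩ := h
  refine ⟨B₂ * latticeConst (d + 1) δ, mul_pos hB (latticeConst_succ_pos hδ), ?_⟩
  intro n M _ _ _hn μ ν J B hJB i
  simp only [Matrix.mulVec_mulVec, ← Matrix.mul_assoc]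
  have h := norm_mulVec_le_of_block_row_sum n M _ hδ (fun i' y' => hblock n M μ ν i' y') J hJB i
  calc _ ≤ B₂ * A n * latticeConst (d + 1) δ * B := h
    _ = B₂ * latticeConst (d + 1) δ * A n * B := by ring

/-- **OPERATOR FORM, GLOBAL: per-block row sums of `Δ_a⁻¹·∇_μ^*·∇_ν^*` with allowance `A(n)` ⟹ `‖Δ_a⁻¹∇_μ^*∇_ν^*‖_{ℓ^∞→ℓ^∞} ≤ B₂·K_{d+1}(δ)·A(n)`**,
uniformly in the torus — the requester's `‖G′∂′ᴴ∂′ᴴ‖_{∞→∞}` letter in the vector currency (with `A n = 1 + log n`: the body of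
`Sup112GDivDivLog d a`). [folklore] -/
theorem sup112GDivDiv_of_block_row_sum
    (h : ∃ B₂ δ : ℝ, 0 < B₂ ∧ 0 < δ ∧ ∀ (n : ℕ) (M : Fin (d + 1) → ℕ) [NeZero n] [∀ μ, NeZero (M μ)],
      ∀ (μ ν : Fin (d + 1)) (i : Tor (fine n M) × Fin (d + 1)) (y' : Tor M),
        ∑ x' : Tor (fine n M) × Fin (d + 1),
            (if blockOf n M x'.1 = y' then
              ‖((DeltaA n M a)⁻¹ * (fdiff (fine n M) (n : ℂ) μ)ᴴ * (fdiff (fine n M) (n : ℂ) ν)ᴴ) i x'‖ else 0)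
          ≤ B₂ * A n * Real.exp (-(δ * torusSupNorm M (rep M (blockOf n M i.1) - rep M y')))) :
    ∃ C : ℝ, 0 < C ∧
      ∀ (n : ℕ) (M : Fin (d + 1) → ℕ) [NeZero n] [∀ μ, NeZero (M μ)], 1 ≤ n →
        ∀ (μ ν : Fin (d + 1)) (J : Tor (fine n M) × Fin (d + 1) → ℂ) (B : ℝ), (∀ j, ‖J j‖ ≤ B) →
          ∀ i, ‖((DeltaA n M a)⁻¹ *ᵥ ((fdiff (fine n M) (n : ℂ) μ)ᴴ *ᵥ ((fdiff (fine n M) (n : ℂ) ν)ᴴ *ᵥ J))) i‖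
              ≤ C * A n * B := by
  obtain ⟨B₂, δ, hB, hδ, hblock⟩ := h
  refine ⟨B₂ * latticeConst (d + 1) δ, mul_pos hB (latticeConst_succ_pos hδ), ?_⟩
  intro n M _ _ _hn μ ν J B hJB i
  simp only [Matrix.mulVec_mulVec, ← Matrix.mul_assoc]
  have h := norm_mulVec_le_of_block_row_sum n M _ hδ (fun i' y' => hblock n M μ ν i' y') J hJB i
  calc _ ≤ B₂ * A n * latticeConst (d + 1) δ * B := h
    _ = B₂ * latticeConst (d + 1) δ * A n * B := by ring

end Reductions

/-! ## §2 ENDs at `a = 1` on CUBIC unit tori with the `(1 + log n)` allowance, CONDITIONAL on the flat second-order rows -/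

section Ends

variable (d)

/-- **ROW FORM, LOCALIZED, `a = 1`, CUBIC TORI — CONDITIONAL ON THE FLAT SECOND-ORDER ROWS**: if the flat suppliers' END holds in its
announced shape (`∃ B₂ δ > 0, ∀ k N L, j ≤ k, μ ν p y₁, Σ_{q : cubeI j q = y₁} |rowDiff μ (rowDiff ν (gFlat j)) p q| ≤ B₂·(1 + log L^j)·e^{−δ·nbd}`
— NOT proved here), then for every `n ≥ 1`, every cubic unit torus `Π ℤ∕N₀`, all `μ ν y y′`, every `J` supported in `B(y′)` with `|J| ≤ B`,
every site `x = n·y + r` and component `κ`: `‖(∇_μ∇_νΔ_1⁻¹J)_κ(x)‖ ≤ C·(1 + log n)·e^{−δ₀|y−y′|_∞}·B` — the body of `Entry112GradGradLog d 1`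
at `M := fun _ => N₀`. [folklore] -/
theorem entry112GradGrad_one_cubic_of_flat
    (hflat : ∃ B₂ δ : ℝ, 0 < B₂ ∧ 0 < δ ∧ ∀ (k N L : ℕ) [NeZero N] [NeZero L] (j : ℕ), j ≤ k →
      ∀ (μ ν : Fin (d + 1)) (p : TPt (d + 1) (N * L ^ k) × Fin (d + 1)) (y₁ : TPt (d + 1) (levM k N L j)),
        ∑ q ∈ Finset.univ.filter (fun q => cubeI (d + 1) k N L (Fin (d + 1)) j q = y₁),
            |rowDiff d k N L μ (rowDiff d k N L ν (gFlat d k N L j)) p q|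
          ≤ B₂ * (1 + Real.log ((L : ℝ) ^ j))
            * Real.exp (-(δ * nbd (d + 1) k N L j (cubeI (d + 1) k N L (Fin (d + 1)) j p) y₁))) :
    ∃ δ₀ C : ℝ, 0 < δ₀ ∧ 0 < C ∧
      ∀ (n N₀ : ℕ) [NeZero n] [NeZero N₀], 1 ≤ n →
        ∀ (μ ν : Fin (d + 1)) (y y' : Fin (d + 1) → ℤ) (J : Tor (fine n (fun _ : Fin (d + 1) => N₀)) × Fin (d + 1) → ℂ) (B : ℝ),
          (∀ j, ‖J j‖ ≤ B) →
          (∀ j, J j ≠ 0 → ∃ r' : Fin (d + 1) → Fin n,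
              j.1 = bpt n (fun _ : Fin (d + 1) => N₀) (toT (fun _ : Fin (d + 1) => N₀) y') r') →
          ∀ (r : Fin (d + 1) → Fin n) (κ : Fin (d + 1)),
            ‖(fdiff (fine n (fun _ : Fin (d + 1) => N₀)) (n : ℂ) μ *ᵥ (fdiff (fine n (fun _ : Fin (d + 1) => N₀)) (n : ℂ) ν *ᵥ
                ((DeltaA n (fun _ : Fin (d + 1) => N₀) 1)⁻¹ *ᵥ J))) (bpt n (fun _ : Fin (d + 1) => N₀) (toT (fun _ : Fin (d + 1) => N₀) y) r, κ)‖
              ≤ C * (1 + Real.log n) * Real.exp (-(δ₀ * torusSupNorm (fun _ : Fin (d + 1) => N₀) (y - y'))) * B := by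
  obtain ⟨B₂, δ, hB, hδ, hblock⟩ := block_row_sum_fdiff_fdiff_inv_le_cubic_of_flat (d := d) hflat
  refine ⟨δ, B₂, hδ, hB, ?_⟩
  intro n N₀ _ _ _hn μ ν y y' J B hJB hsupp r κ
  simp only [Matrix.mulVec_mulVec, ← Matrix.mul_assoc]
  exact norm_mulVec_bpt_le_of_block_row_sum n (fun _ : Fin (d + 1) => N₀) _ (fun i y₁ => hblock n N₀ μ ν i y₁)
    y y' J hJB hsupp r κ

/-- **ROW FORM, GLOBAL, `a = 1`, CUBIC TORI — CONDITIONAL ON THE FLAT SECOND-ORDER ROWS**: under the same hypothesis, `∃ C > 0` with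
`‖(∇_μ∇_νΔ_1⁻¹J)(i)‖ ≤ C·(1 + log n)·|J|` for every `n ≥ 1`, every cubic unit torus, all `μ ν J i` — the body of `Sup112GradGradLog d 1` at
`M := fun _ => N₀`. [folklore] -/
theorem sup112GradGrad_one_cubic_of_flat
    (hflat : ∃ B₂ δ : ℝ, 0 < B₂ ∧ 0 < δ ∧ ∀ (k N L : ℕ) [NeZero N] [NeZero L] (j : ℕ), j ≤ k →
      ∀ (μ ν : Fin (d + 1)) (p : TPt (d + 1) (N * L ^ k) × Fin (d + 1)) (y₁ : TPt (d + 1) (levM k N L j)),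
        ∑ q ∈ Finset.univ.filter (fun q => cubeI (d + 1) k N L (Fin (d + 1)) j q = y₁),
            |rowDiff d k N L μ (rowDiff d k N L ν (gFlat d k N L j)) p q|
          ≤ B₂ * (1 + Real.log ((L : ℝ) ^ j))
            * Real.exp (-(δ * nbd (d + 1) k N L j (cubeI (d + 1) k N L (Fin (d + 1)) j p) y₁))) :
    ∃ C : ℝ, 0 < C ∧
      ∀ (n N₀ : ℕ) [NeZero n] [NeZero N₀], 1 ≤ n →
        ∀ (μ ν : Fin (d + 1)) (J : Tor (fine n (fun _ : Fin (d + 1) => N₀)) × Fin (d + 1) → ℂ) (B : ℝ), (∀ j, ‖J j‖ ≤ B) →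
          ∀ i, ‖(fdiff (fine n (fun _ : Fin (d + 1) => N₀)) (n : ℂ) μ *ᵥ (fdiff (fine n (fun _ : Fin (d + 1) => N₀)) (n : ℂ) ν *ᵥ
                ((DeltaA n (fun _ : Fin (d + 1) => N₀) 1)⁻¹ *ᵥ J))) i‖
              ≤ C * (1 + Real.log n) * B := by
  obtain ⟨B₂, δ, hB, hδ, hblock⟩ := block_row_sum_fdiff_fdiff_inv_le_cubic_of_flat (d := d) hflat
  refine ⟨B₂ * latticeConst (d + 1) δ, mul_pos hB (latticeConst_succ_pos hδ), ?_⟩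
  intro n N₀ _ _ _hn μ ν J B hJB i
  simp only [Matrix.mulVec_mulVec, ← Matrix.mul_assoc]
  have h := norm_mulVec_le_of_block_row_sum n (fun _ : Fin (d + 1) => N₀) _ hδ (fun i' y' => hblock n N₀ μ ν i' y') J hJB i
  calc _ ≤ B₂ * (1 + Real.log n) * latticeConst (d + 1) δ * B := h
    _ = B₂ * latticeConst (d + 1) δ * (1 + Real.log n) * B := by ring

/-- **OPERATOR FORM, LOCALIZED, `a = 1`, CUBIC TORI — CONDITIONAL ON THE FLAT OPERATOR-FORM ROWS**: if the flat suppliers' operator-form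
END holds in its announced shape (`∃ B₂ δ > 0, ∀ k N L, j ≤ k, μ ν p y₁, Σ_{q : cubeI j q = y₁} |(gFlat j·colDiff μ·colDiff ν)(p,q)| ≤
B₂·(1 + log L^j)·e^{−δ·nbd}` — NOT proved here), then for every `n ≥ 1`, every cubic unit torus, all `μ ν y y′`, every `J` supported in
`B(y′)` with `|J| ≤ B`, every site `x = n·y + r` and component `κ`: `‖(Δ_1⁻¹∇_μ^*∇_ν^*J)_κ(x)‖ ≤ C·(1 + log n)·e^{−δ₀|y−y′|_∞}·B` — the body of
`Entry112GDivDivLog d 1` at `M := fun _ => N₀`. [folklore] -/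
theorem entry112GDivDiv_one_cubic_of_flat
    (hflat : ∃ B₂ δ : ℝ, 0 < B₂ ∧ 0 < δ ∧ ∀ (k N L : ℕ) [NeZero N] [NeZero L] (j : ℕ), j ≤ k →
      ∀ (μ ν : Fin (d + 1)) (p : TPt (d + 1) (N * L ^ k) × Fin (d + 1)) (y₁ : TPt (d + 1) (levM k N L j)),
        ∑ q ∈ Finset.univ.filter (fun q => cubeI (d + 1) k N L (Fin (d + 1)) j q = y₁),
            |(gFlat d k N L j * colDiff d k N L μ * colDiff d k N L ν) p q|
          ≤ B₂ * (1 + Real.log ((L : ℝ) ^ j))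
            * Real.exp (-(δ * nbd (d + 1) k N L j (cubeI (d + 1) k N L (Fin (d + 1)) j p) y₁))) :
    ∃ δ₀ C : ℝ, 0 < δ₀ ∧ 0 < C ∧
      ∀ (n N₀ : ℕ) [NeZero n] [NeZero N₀], 1 ≤ n →
        ∀ (μ ν : Fin (d + 1)) (y y' : Fin (d + 1) → ℤ) (J : Tor (fine n (fun _ : Fin (d + 1) => N₀)) × Fin (d + 1) → ℂ) (B : ℝ),
          (∀ j, ‖J j‖ ≤ B) →
          (∀ j, J j ≠ 0 → ∃ r' : Fin (d + 1) → Fin n,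
              j.1 = bpt n (fun _ : Fin (d + 1) => N₀) (toT (fun _ : Fin (d + 1) => N₀) y') r') →
          ∀ (r : Fin (d + 1) → Fin n) (κ : Fin (d + 1)),
            ‖((DeltaA n (fun _ : Fin (d + 1) => N₀) 1)⁻¹ *ᵥ ((fdiff (fine n (fun _ : Fin (d + 1) => N₀)) (n : ℂ) μ)ᴴ *ᵥ
                ((fdiff (fine n (fun _ : Fin (d + 1) => N₀)) (n : ℂ) ν)ᴴ *ᵥ J)))
                (bpt n (fun _ : Fin (d + 1) => N₀) (toT (fun _ : Fin (d + 1) => N₀) y) r, κ)‖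
              ≤ C * (1 + Real.log n) * Real.exp (-(δ₀ * torusSupNorm (fun _ : Fin (d + 1) => N₀) (y - y'))) * B := by
  obtain ⟨B₂, δ, hB, hδ, hblock⟩ := block_row_sum_inv_fdiffH_fdiffH_le_cubic_of_flat (d := d) hflat
  refine ⟨δ, B₂, hδ, hB, ?_⟩
  intro n N₀ _ _ _hn μ ν y y' J B hJB hsupp r κ
  simp only [Matrix.mulVec_mulVec, ← Matrix.mul_assoc]
  exact norm_mulVec_bpt_le_of_block_row_sum n (fun _ : Fin (d + 1) => N₀) _ (fun i y₁ => hblock n N₀ μ ν i y₁)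
    y y' J hJB hsupp r κ

/-- **OPERATOR FORM, GLOBAL, `a = 1`, CUBIC TORI — CONDITIONAL ON THE FLAT OPERATOR-FORM ROWS**: under the same hypothesis, `∃ C > 0` with
`‖(Δ_1⁻¹∇_μ^*∇_ν^*J)(i)‖ ≤ C·(1 + log n)·|J|` for every `n ≥ 1`, every cubic unit torus, all `μ ν J i`, i.e.
**`‖Δ_1⁻¹∇_μ^*∇_ν^*‖_{ℓ^∞→ℓ^∞} ≤ C·(1 + log n)`** — the requester's `‖G′∂′ᴴ∂′ᴴ‖_{∞→∞}` letter in the vector currency on cubic tori, the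
body of `Sup112GDivDivLog d 1` at `M := fun _ => N₀`. [folklore] -/
theorem sup112GDivDiv_one_cubic_of_flat
    (hflat : ∃ B₂ δ : ℝ, 0 < B₂ ∧ 0 < δ ∧ ∀ (k N L : ℕ) [NeZero N] [NeZero L] (j : ℕ), j ≤ k →
      ∀ (μ ν : Fin (d + 1)) (p : TPt (d + 1) (N * L ^ k) × Fin (d + 1)) (y₁ : TPt (d + 1) (levM k N L j)),
        ∑ q ∈ Finset.univ.filter (fun q => cubeI (d + 1) k N L (Fin (d + 1)) j q = y₁),
            |(gFlat d k N L j * colDiff d k N L μ * colDiff d k N L ν) p q|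
          ≤ B₂ * (1 + Real.log ((L : ℝ) ^ j))
            * Real.exp (-(δ * nbd (d + 1) k N L j (cubeI (d + 1) k N L (Fin (d + 1)) j p) y₁))) :
    ∃ C : ℝ, 0 < C ∧
      ∀ (n N₀ : ℕ) [NeZero n] [NeZero N₀], 1 ≤ n →
        ∀ (μ ν : Fin (d + 1)) (J : Tor (fine n (fun _ : Fin (d + 1) => N₀)) × Fin (d + 1) → ℂ) (B : ℝ), (∀ j, ‖J j‖ ≤ B) →
          ∀ i, ‖((DeltaA n (fun _ : Fin (d + 1) => N₀) 1)⁻¹ *ᵥ ((fdiff (fine n (fun _ : Fin (d + 1) => N₀)) (n : ℂ) μ)ᴴ *ᵥ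
                ((fdiff (fine n (fun _ : Fin (d + 1) => N₀)) (n : ℂ) ν)ᴴ *ᵥ J))) i‖
              ≤ C * (1 + Real.log n) * B := by
  obtain ⟨B₂, δ, hB, hδ, hblock⟩ := block_row_sum_inv_fdiffH_fdiffH_le_cubic_of_flat (d := d) hflat
  refine ⟨B₂ * latticeConst (d + 1) δ, mul_pos hB (latticeConst_succ_pos hδ), ?_⟩
  intro n N₀ _ _ _hn μ ν J B hJB i
  simp only [Matrix.mulVec_mulVec, ← Matrix.mul_assoc]
  have h := norm_mulVec_le_of_block_row_sum n (fun _ : Fin (d + 1) => N₀) _ hδ (fun i' y' => hblock n N₀ μ ν i' y') J hJB i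
  calc _ ≤ B₂ * (1 + Real.log n) * latticeConst (d + 1) δ * B := h
    _ = B₂ * latticeConst (d + 1) δ * (1 + Real.log n) * B := by ring

end Ends

end Summit.QuantumFields.BalabanUV.Beta.GAN24.Entry112SupLogCubic

end
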